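import Mathlib
import Summits.ValiantsHypothesis.ValiantsHypothesis.Theorems.BarrierLeverTransversalMinorLayoutsLowerSetsSize

/-!
# Route BarrierLever — conjecture TT (stmt-ValiantsHypothesis-19152): the LOCKED-COMPLEX core

Seat val-np-p2 gen 3.  Combining the literal-pair split R1 (item 19587,
`Theses.BarrierLever.TransversalLiteralPairSplit`, taken here as a hypothesis) with the reduction of
TT to pairs of simplicial complexes (`tt_sameSize_of_lowerSets`, p448941 / part 2) gives a sharper
residue than the irreducible core of item 19616: **TT follows from R1 and TT on LOCKED COMPLEX PAIRS**
— injective layouts `u, w` of the same size whose ranges are lower sets and such that for all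
coordinates `a, c` and bits `β, γ` the classes `#{i : (a ∈ u i) = β}` and `#{j : (c ∈ w j) = γ}` have
different sizes (`transversalMinorLayoutsNonsingular_of_literalPairSplit_of_lockedComplexes`).  For
complexes these class sizes are the vertex degrees and their complements
(`card_filter_mem_le_of_isLowerSet`), so "locked" means: equal face numbers, disjoint vertex-degree
sets (degree 0 of a non-vertex included); the twin-free reduction R2 is not needed (for a complex a
coordinate projection is injective iff the coordinate is a non-vertex, an R1 case with `m = 0`).
Proof: induction on the dimension; inside, strong induction on the size `r`; reduce to lower sets at
fixed `(h, r)`; an unlocked pair is re-indexed into R1's block form (`blockPerm`) and split — the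
projected `k`-block is one dimension down (outer hypothesis; projections of a class with constant
`a`-bit stay injective), the complementary `m`-block is smaller (inner hypothesis).

Definition-free.  WHAT THIS IS NOT: R1 is a hypothesis here (item 19587 is being proved by another
seat); no proof of TT; nothing on crux 14610 or VP versus VNP.
-/

-- layout Summits/ValiantsHypothesis/ValiantsHypothesis forces the duplicated namespace component
set_option linter.dupNamespace false

open Matrix Finset

namespace Summit.ValiantsHypothesis.ValiantsHypothesis.Theorems.BarrierLever.Compression

/-! ## 1. Re-indexing the members -/

/-- Goodness of a layout pair is invariant under re-indexing the members on each side
(row and column permutations of the layout matrix). -/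
theorem tt_layout_of_perm (h r : ℕ) (u w : Fin r → Finset (Fin h)) (σ τ : Equiv.Perm (Fin r))
    (hgood : ∃ H : Matrix (Fin (h + h)) (Fin (h + h)) ℂ, (Matrix.of fun i j : Fin r => (H.submatrix
      (fun b : Fin h => if b ∈ u (σ i) then Fin.castAdd h b else Fin.natAdd h b)
      (fun b : Fin h => if b ∈ w (τ j) then Fin.natAdd h b else Fin.castAdd h b)).det).det ≠ 0) :
    ∃ H : Matrix (Fin (h + h)) (Fin (h + h)) ℂ, (Matrix.of fun i j : Fin r => (H.submatrix
      (fun b : Fin h => if b ∈ u i then Fin.castAdd h b else Fin.natAdd h b)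
      (fun b : Fin h => if b ∈ w j then Fin.natAdd h b else Fin.castAdd h b)).det).det ≠ 0 := by
  obtain ⟨H, hH⟩ := hgood
  refine ⟨H, ?_⟩
  set M : Matrix (Fin r) (Fin r) ℂ := Matrix.of fun i j : Fin r => (H.submatrix
      (fun b : Fin h => if b ∈ u i then Fin.castAdd h b else Fin.natAdd h b)
      (fun b : Fin h => if b ∈ w j then Fin.natAdd h b else Fin.castAdd h b)).det with hM
  have hre : (Matrix.of fun i j : Fin r => (H.submatrix
      (fun b : Fin h => if b ∈ u (σ i) then Fin.castAdd h b else Fin.natAdd h b)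
      (fun b : Fin h => if b ∈ w (τ j) then Fin.natAdd h b else Fin.castAdd h b)).det) =
      (M.submatrix σ id).submatrix id τ := by
    ext i j; simp [hM]
  rw [hre, Matrix.det_permute', Matrix.det_permute] at hH
  intro h0
  apply hH
  rw [h0, mul_zero, mul_zero]

/-- A permutation of `Fin (k + m)` sending the first `k` indices into a given `k`-set `S` and the
last `m` indices into its complement. -/
theorem exists_blockPerm {k m : ℕ} (S : Finset (Fin (k + m))) (hS : S.card = k) :
    ∃ σ : Equiv.Perm (Fin (k + m)), (∀ i : Fin k, σ (Fin.castAdd m i) ∈ S) ∧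
      (∀ i : Fin m, σ (Fin.natAdd k i) ∉ S) := by
  classical
  have hSc : Sᶜ.card = m := by
    rw [Finset.card_compl, hS, Fintype.card_fin]; omega
  let eS : Fin k ≃ {x // x ∈ S} := (S.orderIsoOfFin hS).toEquiv
  let eSc : Fin m ≃ {x // x ∉ S} :=
    ((Sᶜ.orderIsoOfFin hSc).toEquiv).trans (Equiv.subtypeEquivRight (fun x => by simp))
  refine ⟨finSumFinEquiv.symm.trans ((Equiv.sumCongr eS eSc).trans (Equiv.sumCompl (· ∈ S))),
    fun i => ?_, fun i => ?_⟩
  · simp only [Equiv.trans_apply, finSumFinEquiv_symm_apply_castAdd, Equiv.sumCongr_apply,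
      Sum.map_inl, Equiv.sumCompl_apply_inl]
    exact (eS i).2
  · simp only [Equiv.trans_apply, finSumFinEquiv_symm_apply_natAdd, Equiv.sumCongr_apply,
      Sum.map_inr, Equiv.sumCompl_apply_inr]
    exact (eSc i).2

/-! ## 2. Projections of a class with constant bit -/

/-- Deleting a coordinate on which all members of an injective block agree keeps them distinct. -/
theorem proj_injective_of_const_bit {h k : ℕ} (v : Fin k → Finset (Fin (h + 1)))
    (hv : Function.Injective v) (a : Fin (h + 1)) (β : Bool) (hβ : ∀ i, a ∈ v i ↔ β = true) :
    Function.Injective (fun i => Finset.univ.filter fun b : Fin h => a.succAbove b ∈ v i) := by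
  classical
  intro i j hij
  apply hv
  ext x
  by_cases hx : x = a
  · subst hx
    rw [hβ i, hβ j]
  · obtain ⟨b, rfl⟩ := Fin.exists_succAbove_eq hx
    have := congrArg (fun s : Finset (Fin h) => b ∈ s) hij
    simpa using this

/-! ## 3. The induction -/

/-- Flipping both bits turns a pair of equal classes into a pair of equal complementary classes. -/
theorem card_filter_iff_not (r h : ℕ) (u : Fin r → Finset (Fin h)) (a : Fin h) (β : Bool) :
    (Finset.univ.filter fun i => (a ∈ u i ↔ (!β) = true)).card =
      r - (Finset.univ.filter fun i => (a ∈ u i ↔ β = true)).card := by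
  classical
  have hc := Finset.card_filter_add_card_filter_not
    (s := (Finset.univ : Finset (Fin r))) (fun i => (a ∈ u i ↔ β = true))
  have heq : (Finset.univ.filter fun i => (a ∈ u i ↔ (!β) = true)) =
      Finset.univ.filter fun i => ¬ (a ∈ u i ↔ β = true) := by
    ext i
    cases β <;> simp
  rw [heq]
  simp only [Finset.card_univ, Fintype.card_fin] at hc ⊢
  omega

/-- **TT from R1 and the locked-complex core.**  If the literal-pair split R1 (item 19587) holds
and the TT layout matrix is nonsingular for some `H` for every LOCKED pair of complexes — injective
layouts of equal size with lower-set ranges such that no literal-pair classes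
`#{i : (a ∈ u i) = β}`, `#{j : (c ∈ w j) = γ}` have equal size — then
`TransversalMinorLayoutsNonsingular` (item 19152) holds. -/
theorem transversalMinorLayoutsNonsingular_of_literalPairSplit_of_lockedComplexes
    (R1 : Theses.BarrierLever.TransversalLiteralPairSplit)
    (core : ∀ (h r : ℕ) (u w : Fin r → Finset (Fin h)), Function.Injective u →
      Function.Injective w → IsLowerSet (Set.range u) → IsLowerSet (Set.range w) →
      (∀ (a c : Fin h) (β γ : Bool),
        (Finset.univ.filter fun i => (a ∈ u i ↔ β = true)).card ≠
          (Finset.univ.filter fun j => (c ∈ w j ↔ γ = true)).card) →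
      ∃ H : Matrix (Fin (h + h)) (Fin (h + h)) ℂ, (Matrix.of fun i j : Fin r => (H.submatrix
        (fun b : Fin h => if b ∈ u i then Fin.castAdd h b else Fin.natAdd h b)
        (fun b : Fin h => if b ∈ w j then Fin.natAdd h b else Fin.castAdd h b)).det).det ≠ 0) :
    Theses.BarrierLever.TransversalMinorLayoutsNonsingular := by
  classical
  intro h
  induction h with
  | zero =>
    intro r u w hu hw
    refine tt_sameSize_of_lowerSets 0 r (fun u w hu hw hlu hlw => ?_) u w hu hw
    exact core 0 r u w hu hw hlu hlw (fun a => Fin.elim0 a)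
  | succ h ih =>
    intro r
    induction r using Nat.strong_induction_on with
    | _ r ihr =>
    intro u w hu hw
    refine tt_sameSize_of_lowerSets (h + 1) r (fun u w hu hw hlu hlw => ?_) u w hu hw
    by_cases hlk : ∀ (a c : Fin (h + 1)) (β γ : Bool),
        (Finset.univ.filter fun i => (a ∈ u i ↔ β = true)).card ≠
          (Finset.univ.filter fun j => (c ∈ w j ↔ γ = true)).card
    · exact core (h + 1) r u w hu hw hlu hlw hlk
    push Not at hlk
    -- size 0 is trivial
    rcases Nat.eq_zero_or_pos r with hr0 | hrpos
    · subst hr0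
      exact ⟨0, by simp [Matrix.det_isEmpty]⟩
    -- an unlocked pair: classes of equal POSITIVE size `k`
    obtain ⟨a, c, β, γ, hkpos, hk⟩ : ∃ (a c : Fin (h + 1)) (β γ : Bool),
        0 < (Finset.univ.filter fun i => (a ∈ u i ↔ β = true)).card ∧
        (Finset.univ.filter fun i => (a ∈ u i ↔ β = true)).card =
          (Finset.univ.filter fun j => (c ∈ w j ↔ γ = true)).card := by
      obtain ⟨a, c, β, γ, hk⟩ := hlk
      by_cases h0 : (Finset.univ.filter fun i => (a ∈ u i ↔ β = true)).card = 0
      · refine ⟨a, c, !β, !γ, ?_, ?_⟩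
        · rw [card_filter_iff_not, h0]; omega
        · rw [card_filter_iff_not, card_filter_iff_not, ← hk]
      · exact ⟨a, c, β, γ, Nat.pos_of_ne_zero h0, hk⟩
    obtain ⟨k, hSk⟩ : ∃ k, (Finset.univ.filter fun i => (a ∈ u i ↔ β = true)).card = k :=
      ⟨_, rfl⟩
    obtain ⟨m, hkm⟩ : ∃ m, r = k + m := ⟨r - k, by
      have := Finset.card_le_univ (Finset.univ.filter fun i => (a ∈ u i ↔ β = true))
      simp only [Fintype.card_fin] at this; omega⟩
    subst hkm
    set S : Finset (Fin (k + m)) := Finset.univ.filter fun i => (a ∈ u i ↔ β = true) with hSdef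
    set T : Finset (Fin (k + m)) := Finset.univ.filter fun j => (c ∈ w j ↔ γ = true) with hTdef
    have hTk : T.card = k := hk.symm.trans hSk
    -- block re-indexings
    obtain ⟨σ, hσ1, hσ2⟩ := exists_blockPerm S hSk
    obtain ⟨τ, hτ1, hτ2⟩ := exists_blockPerm T hTk
    have hS : ∀ i, σ i ∈ S ↔ (a ∈ u (σ i) ↔ β = true) := fun i => by
      rw [hSdef, Finset.mem_filter]; simp
    have hT : ∀ j, τ j ∈ T ↔ (c ∈ w (τ j) ↔ γ = true) := fun j => by
      rw [hTdef, Finset.mem_filter]; simp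
    refine tt_layout_of_perm (h + 1) (k + m) u w σ τ ?_
    refine R1 h k m (fun i => u (σ i)) (fun j => w (τ j)) a c β γ ?_ ?_ ?_ ?_ ?_ ?_
    · intro i; exact (hS _).mp (hσ1 i)
    · intro i
      have hn := hσ2 i
      rw [hS] at hn
      revert hn
      cases β <;> simp
    · intro j; exact (hT _).mp (hτ1 j)
    · intro j
      have hn := hτ2 j
      rw [hT] at hn
      revert hn
      cases γ <;> simp
    · -- projected k-block, one dimension down
      refine ih k _ _ ?_ ?_
      · refine proj_injective_of_const_bit (fun i => u (σ (Fin.castAdd m i))) ?_ a β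
          (fun i => (hS _).mp (hσ1 i))
        intro i j hij
        exact Fin.castAdd_injective _ _ (σ.injective (hu hij))
      · refine proj_injective_of_const_bit (fun j => w (τ (Fin.castAdd m j))) ?_ c γ
          (fun j => (hT _).mp (hτ1 j))
        intro i j hij
        exact Fin.castAdd_injective _ _ (τ.injective (hw hij))
    · -- complementary m-block, same dimension, fewer members
      refine ihr m (by omega) _ _ ?_ ?_
      · intro i j hij
        exact Fin.natAdd_injective _ _ (σ.injective (hu hij))
      · intro i j hij
        exact Fin.natAdd_injective _ _ (τ.injective (hw hij))

end Summit.ValiantsHypothesis.ValiantsHypothesis.Theorems.BarrierLever.Compression
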